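import Summits.AtomisticToContinuum.Crystallization.Theorems.FrustratedLawDichotomyStrainedPatchHomForceNest

/-!
# (C′-2) FORCE/EXEMPT PRUNE, SECOND-ORDER CENTRED form — kernel definitions
# (27623 strained-patch piece, `(H) HomFloor`, hcp half; decomp-a2c hand-2 g28 — critic rows 1043 (B) / 1055 (B): (C′-2)+(C′-3))

The v1 leaf `…HomForceSum.boxSlopeHi` encloses every lattice term of the one-atom move slope NAIVELY over the entry/shuffle box; measured width
`≈ 557·w_U + 106·w_ξ` (first-shell `u⁷` dependency), so it closes only at half-width `≲ 2⁻¹²`.  This module is the CENTRED successor.  For a label `b`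
that is certainly inside the `7`-ball and within `5/2` of the centre ("near"), the term `g(v) = ((Q⁻¹)⁴ − (Q⁻¹)⁷)·⟪τe − v, e⟫`, `Q = ‖τe − v‖²`, of the
displacement `v = v_b(U, ξ)` is expanded to SECOND ORDER about the displacement `v⁰ = v_b(U₀, ξ₀)` at the box centre:

  `g(v) ≤ g(v⁰) + W(v⁰)·(v − v⁰) + ½·sup_{t∈[0,1]} |γ″(t)|`,  `γ(t) = g(v⁰ + t(v − v⁰))`,  `W = −(2φ′(Q⁰)⟪r⁰, e⟫ r⁰ + φ(Q⁰) e)`, `r⁰ = τe − v⁰`,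

the first-order terms are summed over labels WITH SIGNS in the twelve box coordinates (`v − v⁰ = (U − U₀)q_b + U₀(ξ − ξ₀) + (U − U₀)(ξ − ξ₀)`, `q_b` the
reference point) — this keeps the inter-label cancellation that the naive form throws away — and only then bounded by `Σ_k w_k·|coefficient_k|`; the
second-order remainder is bounded per label on the displacement box by `|γ″| ≤ 4|φ″|⟪r,d⟫²|⟪r,e⟫| + 2|φ′|‖d‖²|⟪r,e⟫| + 4|φ′||⟪r,d⟫||⟪d,e⟫|`.
Labels inside the ball but beyond `5/2`, and straddling labels, keep the v1 naive bound `…HomForceSum.termHi`; labels with `‖q_b‖ > 28/3 (+1/4)` are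
outside the ball for every `‖U − 1‖ ≤ 1/4`, `‖ξ‖ ≤ 1/4` and are skipped by an INTEGER pretest (`farA` / `farB`).
MODEL (hand-2 g28, float intervals, Finding-A box of critic row 1019, `e = (.982,.177,.055)`, `s = 10⁻⁶`): point slope `−0.185`; true first-order term
`Σ_k w_k|∂S/∂x_k| = 0.036` at `(w_U, w_ξ) = (2⁻⁹, 2⁻¹⁰)`; second-order remainder `0.018`; naive tail `0.003` ⇒ certified `−0.128 < −0.0108` (v1: `+1.11`).

* §1 `farA` / `farB` (integer pretests), `icc11L` (the label range as a literal list);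
* §2 the accumulator record `Acc` (guard, Σ value, Σ naive, Σ remainder, nine + three signed first-order coefficient interval sums) and `Acc.add`;
* §3 `nearContrib` (the centred per-label data: thin value / gradient at `v⁰`, remainder on the box `v⁰ ± D`), `naiveContrib`, the dispatchers
  `contribA` / `contribB`, the nested single-pass folds `famA` / `famB` ((C′-3): one traversal per family, depth ≤ 3·23);
* §4 the literal family certificate `FamCert`, the one-Boolean checks `checkA` / `checkB` (kernel: ONE evaluation per family against interpreter-computed
  literals), the final integer bound `boundC`, the leaf `forceOutC` (and the certificate-free `forceOutC0`).
Semantics / soundness: companion modules `…HomForceCentredPath` (the one-dimensional second-order lemma) and `…HomForceCentredSound`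
(`forceOutC_sound_of_parts`, the `hver` prune disjunct, same shape as `…HomForceNest.forceOut_sound_of_parts`).
All definitions computable; 0 sorry; axioms standard; no instances / notation.  `--supports stmt-AtomisticToContinuum-27623`.
-/

namespace Summit.AtomisticToContinuum.Crystallization.Theorems.FrustratedLawDichotomyStrainedPatchHomForceCentred

open Literature.Analysis.ValidatedNumerics.Numerics
open Summit.AtomisticToContinuum.Crystallization.Theorems.FrustratedLawDichotomyStrainedPatchHomEntryGram (entryFI)
open Summit.AtomisticToContinuum.Crystallization.Theorems.FrustratedLawDichotomyStrainedPatchHomEntryGramHcp (dot3 shufFI)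
open Summit.AtomisticToContinuum.Crystallization.Theorems.FrustratedLawDichotomyStrainedPatchHomForceKit (vecA vecB dirFI relFI)
open Summit.AtomisticToContinuum.Crystallization.Theorems.FrustratedLawDichotomyStrainedPatchHomForceSum (termHi slopeTestOK dirOK)

/-! ## §1. Integer pretests and the label range -/

/-- `‖P b‖² > (28/3)²` in integers (`‖P b‖² = b₀² + b₀b₁ + b₁² + (8/3)b₂²`): with `‖U − 1‖ ≤ 1/4` the `A`-label `b` lies outside the `7`-ball. -/
def farA (b : Fin 3 → ℤ) : Bool :=
  decide (784 < 9 * (b 0 * b 0 + b 0 * b 1 + b 1 * b 1) + 24 * (b 2 * b 2))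

/-- `‖P b + t‖² > (115/12)²` in integers (`36‖P b + t‖² = (6b₀ + 3b₁ + 3)² + 3(3b₁ + 1)² + 24(2b₂ + 1)²`): with `‖U − 1‖ ≤ 1/4`, `‖ξ‖ ≤ 1/4` the
`B`-label `b` lies outside the `7`-ball. -/
def farB (b : Fin 3 → ℤ) : Bool :=
  decide (13225 < 4 * ((6 * b 0 + 3 * b 1 + 3) * (6 * b 0 + 3 * b 1 + 3) + 3 * ((3 * b 1 + 1) * (3 * b 1 + 1)) +
    24 * ((2 * b 2 + 1) * (2 * b 2 + 1))))

/-- `[−11, 11]` as a literal list (the kernel folds over it; `icc11L_toFinset` in the soundness module). -/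
def icc11L : List ℤ := [-11, -10, -9, -8, -7, -6, -5, -4, -3, -2, -1, 0, 1, 2, 3, 4, 5, 6, 7, 8, 9, 10, 11]

/-- `SC³` as a literal. -/
def SC3 : ℤ := 22300745198530623141535718272648361505980416
/-- `SC⁵` as a literal. -/
def SC5 : ℤ := 1766847064778384329583297500742918515827483896875618958121606201292619776

/-! ## §2. The accumulator -/

/-- Per-family accumulator of the centred leaf (all at scale `SC`): `ok` = every label enclosed; `val` = Σ over near labels of the upper end of the
value `g(v⁰, [0,s])`; `nv` = Σ over the other in/straddling labels of the naive bound `termHi`; `rem` = Σ over near labels of the second-order constant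
(`≥ sup|γ″|·SC`, NOT yet halved); `K (a,c)` ∋ `Σ_near W_a·q_c` and `S a` ∋ `Σ_near W_a` (signed first-order coefficient sums). -/
structure Acc where
  /-- guard -/
  ok : Bool
  /-- Σ near values (upper ends) -/
  val : ℤ
  /-- Σ naive bounds -/
  nv : ℤ
  /-- Σ second-order constants -/
  rem : ℤ
  /-- entry coefficient sums -/
  K : Fin 3 × Fin 3 → FI
  /-- gradient sums -/
  S : Fin 3 → FI

/-- The empty accumulator. -/
def Acc.zero : Acc := ⟨true, 0, 0, 0, fun _ => FI.ofInt 0, fun _ => FI.ofInt 0⟩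

/-- The failing accumulator (some enclosure does not exist). -/
def Acc.bad : Acc := ⟨false, 0, 0, 0, fun _ => FI.ofInt 0, fun _ => FI.ofInt 0⟩

/-- Componentwise sum. -/
def Acc.add (x y : Acc) : Acc :=
  ⟨x.ok && y.ok, x.val + y.val, x.nv + y.nv, x.rem + y.rem, fun ac => (x.K ac).add (y.K ac), fun a => (x.S a).add (y.S a)⟩

/-- Structural fold of per-label accumulators over a list. -/
def foldAcc (f : ℤ → Acc) : List ℤ → Acc
  | [] => Acc.zero
  | k :: ks => (f k).add (foldAcc f ks)

/-- The nested fold over `[−11, 11]³` (labels `![i, j, k]`). -/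
def fold3 (f : (Fin 3 → ℤ) → Acc) : Acc :=
  foldAcc (fun i => foldAcc (fun j => foldAcc (fun k => f ![i, j, k]) icc11L) icc11L) icc11L

/-! ## §3. Per-label contributions -/

/-- `7u⁸ − 4u⁵` (`= φ′(Q)` at `u = 1/Q`). -/
def phi1FI (u : FI) : FI :=
  let u2 := u.mul u
  let u4 := u2.mul u2
  ((u4.mul u4).mulInt 7).sub ((u4.mul u).mulInt 4)

/-- `20u⁶ − 56u⁹` (`= φ″(Q)` at `u = 1/Q`). -/
def phi2FI (u : FI) : FI :=
  let u2 := u.mul u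
  let u4 := u2.mul u2
  ((u4.mul u2).mulInt 20).sub (((u4.mul u4).mul u).mulInt 56)

/-- `u⁴ − u⁷` (`= φ(Q)` at `u = 1/Q`). -/
def phi0FI (u : FI) : FI :=
  let u2 := u.mul u
  let u4 := u2.mul u2
  u4.sub ((u4.mul u2).mul u)

/-- The thin gradient `W = −(2φ′(Q⁰)⟪r⁰,e⟫ r⁰ + φ(Q⁰) e)` from `u0 ∋ 1/Q⁰`, `R0 ∋ r⁰`, `L0 ∋ ⟪r⁰, e⟫`. -/
def gradW (en : Fin 3 → ℤ) (ed : ℕ) (u0 L0 : FI) (R0 : Fin 3 → FI) (a : Fin 3) : FI :=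
  ((((phi1FI u0).mul L0).mulInt 2).mul (R0 a)).add ((phi0FI u0).mul (dirFI en ed a)) |>.neg

/-- The per-label second-order constant `B ≥ sup_{t∈[0,1]} |γ″(t)|·SC` on the hull box: from `uh ∋ 1/Q`, `Rh ∋ r` (components), `Lh ∋ ⟪r,e⟫` over the
box and the scaled half-widths `D` of `d = v − v⁰`:  `4|φ″|·RD²·|L|/SC⁵ + 2|φ′|·DD·|L|/SC³ + 4|φ′|·RD·DE/(ed·SC³)`,
`RD = Σ|r_a|D_a ≥ |⟪r,d⟫|SC²`, `DD = ΣD_a² ≥ ‖d‖²SC²`, `DE = Σ|en_a|D_a ≥ |⟪d,e⟫|·ed·SC`. -/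
def remB (en : Fin 3 → ℤ) (ed : ℕ) (uh Lh : FI) (Rh : Fin 3 → FI) (D : Fin 3 → ℤ) : ℤ :=
  let a1 := FI.absHi (phi1FI uh)
  let a2 := FI.absHi (phi2FI uh)
  let aL := FI.absHi Lh
  let RD := FI.absHi (Rh 0) * D 0 + FI.absHi (Rh 1) * D 1 + FI.absHi (Rh 2) * D 2
  let DD := D 0 * D 0 + D 1 * D 1 + D 2 * D 2
  let DE := |en 0| * D 0 + |en 1| * D 1 + |en 2| * D 2
  cdiv (4 * a2 * RD * RD * aL) SC5 + cdiv (2 * a1 * DD * aL) SC3 + cdiv (4 * a1 * RD * DE) ((ed : ℤ) * SC3)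

/-- Scaled half-widths of the displacement `d = v − v⁰` for the `A` family: `|d_a|·SC ≤ Σ_c w_ac·|q_c|` (`d_a = Σ_c Δu_ac q_c`). -/
def dA (w : (Fin 3 × Fin 3) ⊕ Fin 3 → ℤ) (q : Fin 3 → FI) (a : Fin 3) : ℤ :=
  cdiv (w (Sum.inl (a, 0)) * FI.absHi (q 0) + w (Sum.inl (a, 1)) * FI.absHi (q 1) + w (Sum.inl (a, 2)) * FI.absHi (q 2)) SC

/-- Scaled half-widths of `d` for the `B` family: `d_a = Σ_c Δu_ac q_c + Σ_i u⁰_ai Δξ_i + Σ_i Δu_ai Δξ_i`. -/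
def dB (c w : (Fin 3 × Fin 3) ⊕ Fin 3 → ℤ) (q : Fin 3 → FI) (a : Fin 3) : ℤ :=
  cdiv (w (Sum.inl (a, 0)) * FI.absHi (q 0) + w (Sum.inl (a, 1)) * FI.absHi (q 1) + w (Sum.inl (a, 2)) * FI.absHi (q 2) +
    (|c (Sum.inl (a, 0))| * w (Sum.inr 0) + |c (Sum.inl (a, 1))| * w (Sum.inr 1) + |c (Sum.inl (a, 2))| * w (Sum.inr 2)) +
    (w (Sum.inl (a, 0)) * w (Sum.inr 0) + w (Sum.inl (a, 1)) * w (Sum.inr 1) + w (Sum.inl (a, 2)) * w (Sum.inr 2))) SC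

/-- ★ The CENTRED per-label data of a near label: `V0` = thin components of `v⁰`, `q` = thin components of the reference point (`P b` for `A`,
`P b + t + ξ₀` for `B`), `D` = scaled half-widths of `d = v − v⁰` (the remainder is taken on the box `v⁰ ± D`, which contains the segment).
`Acc.bad` iff one of the two `1/Q` enclosures fails. -/
def nearContrib (en : Fin 3 → ℤ) (ed : ℕ) (sn : ℤ) (sd : ℕ) (V0 q : Fin 3 → FI) (D : Fin 3 → ℤ) : Acc :=
  let Vt : Fin 3 → FI := fun a => (V0 a).widen (D a)
  let R0 := relFI en ed sn sd V0
  let Rh := relFI en ed sn sd Vt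
  match FI.divPos (FI.ofInt 1) (dot3 R0 R0), FI.divPos (FI.ofInt 1) (dot3 Rh Rh) with
  | some u0, some uh =>
    let L0 := dot3 R0 (dirFI en ed)
    let W := gradW en ed u0 L0 R0
    ⟨true, ((phi0FI u0).mul L0).hi, 0, remB en ed uh (dot3 Rh (dirFI en ed)) Rh D, fun ac => (W ac.1).mul (q ac.2), W⟩
  | _, _ => Acc.bad

/-- The naive per-label data (v1 `termHi`): `Acc.bad` iff no enclosure. -/
def naiveContrib (t : Option ℤ) : Acc :=
  match t with
  | some t => ⟨true, 0, t, 0, fun _ => FI.ofInt 0, fun _ => FI.ofInt 0⟩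
  | none => Acc.bad

/-- The squared near radius `(5/2)²·SC`. -/
def near2 : ℤ := 25 * (SC : ℤ) / 4

/-- Identity entries (thin): the reference components `q` are `vecA eId b` / `vecB eId X0 b`. -/
def eId : Fin 3 × Fin 3 → FI := fun ab => if ab.1 = ab.2 then FI.ofInt 1 else FI.ofInt 0

/-- ★ `A`-family dispatcher: pretest-far / zero label ⇒ nothing; certainly out ⇒ nothing; near ⇒ centred; else naive. -/
def contribA (en : Fin 3 → ℤ) (ed : ℕ) (sn : ℤ) (sd : ℕ) (w : (Fin 3 × Fin 3) ⊕ Fin 3 → ℤ) (E E0 : Fin 3 × Fin 3 → FI) (b : Fin 3 → ℤ) :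
    Acc :=
  match farA b with
  | true => Acc.zero
  | false =>
    match decide (b = 0) with
    | true => Acc.zero
    | false =>
      let V := vecA E b
      match decide (49 * (SC : ℤ) < (dot3 V V).lo) with
      | true => Acc.zero
      | false =>
        match decide ((dot3 V V).hi ≤ near2) with
        | true => nearContrib en ed sn sd (vecA E0 b) (vecA eId b) (dA w (vecA eId b))
        | false => naiveContrib (termHi en ed sn sd false V)

/-- ★ `B`-family dispatcher (`X` = shuffle box, `X0` = thin shuffle centre). -/
def contribB (en : Fin 3 → ℤ) (ed : ℕ) (sn : ℤ) (sd : ℕ) (c w : (Fin 3 × Fin 3) ⊕ Fin 3 → ℤ) (E E0 : Fin 3 × Fin 3 → FI) (X X0 : Fin 3 → FI)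
    (b : Fin 3 → ℤ) : Acc :=
  match farB b with
  | true => Acc.zero
  | false =>
    let V := vecB E X b
    match decide (49 * (SC : ℤ) < (dot3 V V).lo) with
    | true => Acc.zero
    | false =>
      match decide ((dot3 V V).hi ≤ near2) with
      | true => nearContrib en ed sn sd (vecB E0 X0 b) (vecB eId X0 b) (dB c w (vecB eId X0 b))
      | false => naiveContrib (termHi en ed sn sd false V)

/-- Box entry intervals of `(c, w)` (twelve-coordinate convention: entries under `Sum.inl`). -/
def boxE (c w : (Fin 3 × Fin 3) ⊕ Fin 3 → ℤ) : Fin 3 × Fin 3 → FI := entryFI (fun ab => c (Sum.inl ab)) (fun ab => w (Sum.inl ab))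
/-- Thin entry intervals of the box centre. -/
def cenE (c : (Fin 3 × Fin 3) ⊕ Fin 3 → ℤ) : Fin 3 × Fin 3 → FI := entryFI (fun ab => c (Sum.inl ab)) (fun _ => 0)
/-- Thin shuffle intervals of the box centre. -/
def cenX (c : (Fin 3 × Fin 3) ⊕ Fin 3 → ℤ) : Fin 3 → FI := shufFI c (fun _ => 0)

/-- ★★ `A`-FAMILY SINGLE-PASS FOLD over `[−11, 11]³`. -/
def famA (en : Fin 3 → ℤ) (ed : ℕ) (sn : ℤ) (sd : ℕ) (c w : (Fin 3 × Fin 3) ⊕ Fin 3 → ℤ) : Acc :=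
  fold3 (contribA en ed sn sd w (boxE c w) (cenE c))

/-- ★★ `B`-FAMILY SINGLE-PASS FOLD over `[−11, 11]³`. -/
def famB (en : Fin 3 → ℤ) (ed : ℕ) (sn : ℤ) (sd : ℕ) (c w : (Fin 3 × Fin 3) ⊕ Fin 3 → ℤ) : Acc :=
  fold3 (contribB en ed sn sd c w (boxE c w) (cenE c) (shufFI c w) (cenX c))

/-! ## §4. Family certificates, the final bound and the leaf -/

/-- A literal family certificate (interpreter-computed; the kernel only CHECKS it): claimed bounds of the accumulator fields. -/
structure FamCert where
  /-- `val ≤ cval` -/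
  cval : ℤ
  /-- `nv ≤ cnv` -/
  cnv : ℤ
  /-- `rem ≤ crem` -/
  crem : ℤ
  /-- `K ac ⊆ [cK ac]` -/
  cK : Fin 3 × Fin 3 → FI
  /-- `S a ⊆ [cS a]` -/
  cS : Fin 3 → FI

/-- Interval containment `I ⊆ J` in the kernel. -/
def subFI (I J : FI) : Bool := decide (J.lo ≤ I.lo) && decide (I.hi ≤ J.hi)

/-- All nine / three containments. -/
def subAll (acc : Acc) (cert : FamCert) : Bool :=
  subFI (acc.K (0, 0)) (cert.cK (0, 0)) && subFI (acc.K (0, 1)) (cert.cK (0, 1)) && subFI (acc.K (0, 2)) (cert.cK (0, 2)) &&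
  subFI (acc.K (1, 0)) (cert.cK (1, 0)) && subFI (acc.K (1, 1)) (cert.cK (1, 1)) && subFI (acc.K (1, 2)) (cert.cK (1, 2)) &&
  subFI (acc.K (2, 0)) (cert.cK (2, 0)) && subFI (acc.K (2, 1)) (cert.cK (2, 1)) && subFI (acc.K (2, 2)) (cert.cK (2, 2)) &&
  subFI (acc.S 0) (cert.cS 0) && subFI (acc.S 1) (cert.cS 1) && subFI (acc.S 2) (cert.cS 2)

/-- An accumulator passes a certificate. -/
def Acc.check (acc : Acc) (cert : FamCert) : Bool :=
  acc.ok && decide (acc.val ≤ cert.cval) && decide (acc.nv ≤ cert.cnv) && decide (acc.rem ≤ cert.crem) && subAll acc cert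

/-- ★★ KERNEL FACT `A`: the `A`-family fold passes the certificate (ONE evaluation of the fold). -/
def checkA (en : Fin 3 → ℤ) (ed : ℕ) (sn : ℤ) (sd : ℕ) (c w : (Fin 3 × Fin 3) ⊕ Fin 3 → ℤ) (cert : FamCert) : Bool :=
  (famA en ed sn sd c w).check cert

/-- ★★ KERNEL FACT `B`. -/
def checkB (en : Fin 3 → ℤ) (ed : ℕ) (sn : ℤ) (sd : ℕ) (c w : (Fin 3 × Fin 3) ⊕ Fin 3 → ℤ) (cert : FamCert) : Bool :=
  (famB en ed sn sd c w).check cert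

/-- Sum over the nine entry coordinates of `⌈w_ac·|K^A_ac + K^B_ac|/SC⌉`. -/
def entryTerm (w : (Fin 3 × Fin 3) ⊕ Fin 3 → ℤ) (cA cB : FamCert) : ℤ :=
  let t : Fin 3 × Fin 3 → ℤ := fun ac => cdiv (w (Sum.inl ac) * FI.absHi ((cA.cK ac).add (cB.cK ac))) SC
  t (0, 0) + t (0, 1) + t (0, 2) + t (1, 0) + t (1, 1) + t (1, 2) + t (2, 0) + t (2, 1) + t (2, 2)

/-- Sum over the three shuffle coordinates of `⌈w_ξi·|Σ_a u⁰_ai S^B_a|/SC⌉` (`u⁰` = thin centre entries). -/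
def shufTerm (c w : (Fin 3 × Fin 3) ⊕ Fin 3 → ℤ) (cB : FamCert) : ℤ :=
  let t : Fin 3 → ℤ := fun i =>
    cdiv (w (Sum.inr i) * FI.absHi ((((cenE c (0, i)).mul (cB.cS 0)).add ((cenE c (1, i)).mul (cB.cS 1))).add ((cenE c (2, i)).mul (cB.cS 2)))) SC
  t 0 + t 1 + t 2

/-- The bilinear remainder `⌈Σ_a |S^B_a|·(Σ_i w_ai w_ξi)/SC²⌉`. -/
def bilTerm (w : (Fin 3 × Fin 3) ⊕ Fin 3 → ℤ) (cB : FamCert) : ℤ :=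
  let m : Fin 3 → ℤ := fun a => w (Sum.inl (a, 0)) * w (Sum.inr 0) + w (Sum.inl (a, 1)) * w (Sum.inr 1) + w (Sum.inl (a, 2)) * w (Sum.inr 2)
  cdiv (cdiv (FI.absHi (cB.cS 0) * m 0 + FI.absHi (cB.cS 1) * m 1 + FI.absHi (cB.cS 2) * m 2) SC) SC

/-- ★★★ THE CENTRED BOX SLOPE BOUND (scaled) assembled from two family certificates. -/
def boundC (c w : (Fin 3 × Fin 3) ⊕ Fin 3 → ℤ) (cA cB : FamCert) : ℤ :=
  cA.cval + cB.cval + cA.cnv + cB.cnv + cdiv (cA.crem + cB.crem) 2 + entryTerm w cA cB + shufTerm c w cB + bilTerm w cB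

/-- ★★★ **`forceOutC`** — the centred force/exempt prune leaf for ONE direction `en/ed`, step `sn/sd`, box `(c, w)` and two family certificates:
direction at most unit, both family checks, threshold test on `boundC`.  (For sharding, the conjuncts are separate kernel facts —
`…HomForceCentredSound.forceOutC_sound_of_parts`; MEASURED on the Finding-A box at `(2⁻⁹, 2⁻¹⁰)`, `s = 10⁻⁶`, `e = (.982,.177,.055)`: `checkA` 47 s,
`checkB` 49 s kernel, `boundC = −0.1214·SC` (`val −0.1858`, naive `0.0050`, remainder `0.0233`, entry term `0.0277`, shuffle term `0.0084`, bilinear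
`0.00005`) `< −0.0108·SC` ⇒ FIRES; `(2⁻⁹,2⁻⁹)`: `−0.102` ✓, `(2⁻¹⁰,2⁻¹⁰)`: `−0.153` ✓, `(2⁻⁸,2⁻⁹)`: `+0.008` ✗; at `s = 10⁻³` the `τ`-width costs `0.09`.) -/
def forceOutC (en : Fin 3 → ℤ) (ed : ℕ) (sn : ℤ) (sd : ℕ) (c w : (Fin 3 × Fin 3) ⊕ Fin 3 → ℤ) (cA cB : FamCert) : Bool :=
  dirOK en ed && decide (0 < sd) && checkA en ed sn sd c w cA && checkB en ed sn sd c w cB && slopeTestOK (boundC c w cA cB) sn sd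

/-- The exact certificate of an accumulator (its own field values). -/
def Acc.cert (a : Acc) : FamCert := ⟨a.val, a.nv, a.rem, a.K, a.S⟩

/-- Certificate-free variant (both family folds evaluated in ONE term; for the interpreter / `native` drivers and small kernel boxes — the sharded
form `forceOutC` is the one whose kernel cost was measured: 47 s + 49 s for the Finding-A box at `(2⁻⁹, 2⁻¹⁰)`). -/
def forceOutC0 (en : Fin 3 → ℤ) (ed : ℕ) (sn : ℤ) (sd : ℕ) (c w : (Fin 3 × Fin 3) ⊕ Fin 3 → ℤ) : Bool :=
  let A := famA en ed sn sd c w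
  let B := famB en ed sn sd c w
  dirOK en ed && decide (0 < sd) && A.ok && B.ok && slopeTestOK (boundC c w A.cert B.cert) sn sd

end Summit.AtomisticToContinuum.Crystallization.Theorems.FrustratedLawDichotomyStrainedPatchHomForceCentred
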